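import Mathlib
import Summits.NavierStokesRegularity.NavierStokesRegularity.Theorems.EulerZoomLiouvillePowerGaugeEulerLiouvilleNeedleCasimirClock
import Summits.NavierStokesRegularity.NavierStokesRegularity.Theorems.EulerZoomLiouvillePowerGaugeEulerLiouvilleNeedleAxisymBand
import Summits.NavierStokesRegularity.NavierStokesRegularity.Theorems.EulerZoomLiouvillePowerGaugeEulerLiouvilleSelfSimilarBernoulliLandscape
import HarnessLib.Audit

/-!
# Crux E `EulerZoomLiouville.PowerGaugeEulerLiouville` — the needle stratum: the STAY-SET CLOCK LAW
# (ROUND-37 §8 (C′)): vortical points that linger in a ball are exponentially rare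

Route №10 `EulerZoomLiouville` (NavierStokesRegularity), crux E = stmt-NavierStokesRegularity-19832,
registered residue `stub_selfSimilarC2Needle`, memo ROUND-37 of the cell `ns-regularity-ideate`
(nsreg-p2), step **(C′)**.  ONE theorem assembling three landed tools:

* the CASIMIR CLOCK in Cauchy form (plate t38c, `NeedleCasimirClock.norm_curl_comp_mul_cylRadius_eq`):
  along a backward similarity orbit of an axisymmetric swirl-free `C²` profile,
  `‖Ω(Y t)‖ · r⊥(Y 0) = e^{(1+γ)t} ‖Ω(Y 0)‖ · r⊥(Y t)`;
* the BATHTUB (plate t38a, `NeedleAxisymBand.sq_volume_le_integral_cylRadius_sq`):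
  `|A|² / (32 R) ≤ ∫_A r⊥²` for measurable `A ⊆ B̄_R`;
* the VOLUME LAW of the similarity flow (LEAD lineage, `BernoulliLandscape.volume_image_flow_eq_exp_of_stay`):
  `vol(Φ_T A) = e^{3γT} vol A` when all orbits of `A` stay in a ball where the (cut-off) field is
  divergence-free.

**`volume_image_toReal_le_of_stay`.**  `(U, P)` a `C²` profile of CIV (3.3) (`IsSelfSimilarEulerProfile γ 0 U P`),
axisymmetric and swirl-free; `V` a `C²` field with `‖DV‖ ≤ K` agreeing with `U` on the open ball
`‖w‖ < R_big` (the LEAD's cut-off, `AnchoredBudgetEviction.exists_cutoff`), `Φ` its similarity flow,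
`0 < R < R_big`, `0 ≤ T`.  Let `A` be measurable, every orbit `Φ_σ y`, `y ∈ A`, `σ ∈ [0,T]`, staying in
`‖z‖ ≤ R`, and suppose the END points are vortical off the axis: `r⊥(Φ_T y) > 0` and
`‖Ω(Φ_T y)‖ ≥ ξ₀ r⊥(Φ_T y)` (`ξ₀ > 0`, i.e. `|ξ| = |ω_θ|/r⊥ ≥ ξ₀` there).  If `∫_{B̄_R} ‖Ω‖² ≤ B` then

  `vol(Φ_T A) ≤ √(32 R B) · ξ₀⁻¹ · e^{−(1−2γ) T}`.

Reading: `Φ_T A` is the set of points NOW in the ball, off the axis, with `|ξ| ≥ ξ₀`, whose orbit has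
STAYED in the ball during the last `T` units of similarity time; its volume decays like
`e^{−(1−2γ)T}` — the volume law's `e^{−3γT}` (pull back) times the clock's `e^{−(1+γ)T}·` (each such
label carried `|ξ| ≥ ξ₀ e^{(1+γ)T}` a time `T` ago, and the enstrophy budget of the ball is fixed),
combined through the bathtub's square root.  For `γ = 1/(2+ρ) < ½` the rate `1 − 2γ = ρ/(2+ρ) > 0`.
Proof: reverse each orbit (`Y t = Φ_{T−t} y` solves `Y′ = −W(Y)` with the PROFILE's field, since
`V = U` on the ball), apply the clock between `Y 0 = Φ_T y` and `Y T = y`, square, integrate over `A`,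
bathtub, volume law.

References: Constantin–Ignatova–Vicol 2026, §3.4.1 (3.21)–(3.22); KNSS 2009 Remark 5.1 (`ω_θ/r`).
-/

set_option linter.dupNamespace false

noncomputable section

open Set Filter MeasureTheory Topology Metric
open scoped ENNReal NNReal

namespace Summit.NavierStokesRegularity.NavierStokesRegularity.Theorems.PowerGaugeEulerLiouville.NeedleStayClock

open Literature.Analysis Literature.Analysis.FluidPDE
open Summit.NavierStokesRegularity.NavierStokesRegularity.Theorems.PowerGaugeEulerLiouville.C2.Kelvin
open Summit.NavierStokesRegularity.NavierStokesRegularity.Theorems.PowerGaugeEulerLiouville.BernoulliLandscape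
open Summit.NavierStokesRegularity.NavierStokesRegularity.Theorems.PowerGaugeEulerLiouville.NeedleCasimirClock
open Summit.NavierStokesRegularity.NavierStokesRegularity.Theorems.PowerGaugeEulerLiouville.NeedleAxisymBand

variable {γ : ℝ} {U V : EuclideanSpace ℝ (Fin 3) → EuclideanSpace ℝ (Fin 3)}
  {P : EuclideanSpace ℝ (Fin 3) → ℝ}

/-- The transport fields of `U` and of a field `V` agreeing with `U` on a set coincide there. [folklore] -/
theorem selfSimilarTransport_congr {s : Set (EuclideanSpace ℝ (Fin 3))} (hVU : ∀ w ∈ s, V w = U w)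
    {z : EuclideanSpace ℝ (Fin 3)} (hz : z ∈ s) :
    selfSimilarTransport γ 0 V z = selfSimilarTransport γ 0 U z := by
  rw [selfSimilarTransport_apply, selfSimilarTransport_apply, hVU z hz]

/-- **The clock read backwards from a staying orbit.**  If the forward orbit `σ ↦ Φ_σ y` of the cut-off
flow stays, on `[0,T]`, in the ball `‖z‖ ≤ R < R_big` where `V = U`, and its END point is vortical off the
axis (`r⊥(Φ_T y) > 0`, `‖Ω(Φ_T y)‖ ≥ ξ₀ r⊥(Φ_T y)`), then the START point carried
`‖Ω(y)‖ ≥ ξ₀ e^{(1+γ)T} r⊥(y)`. [cite: ConstantinIgnatovaVicol2026Putative, §3.4.1 eq. (3.21)–(3.22)] -/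
theorem mul_exp_mul_cylRadius_le_norm_curl (hprof : IsSelfSimilarEulerProfile γ 0 U P)
    (hax : IsAxisymmetric U) (hsw : HasNoSwirl U) (hV1 : ContDiff ℝ 1 V) {K : ℝ}
    (hK : ∀ y, ‖fderiv ℝ V y‖ ≤ K) {R Rbig : ℝ} (hRbig : R < Rbig)
    (hVU : ∀ w ∈ ball (0 : EuclideanSpace ℝ (Fin 3)) Rbig, V w = U w) {T : ℝ} (hT : 0 ≤ T)
    {y : EuclideanSpace ℝ (Fin 3)}
    (hstay : ∀ σ ∈ Icc 0 T, ‖ODE.evolutionMap (fun _ : ℝ => selfSimilarTransport γ 0 V) 0 σ y‖ ≤ R)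
    {ξ₀ : ℝ}
    (hoff : 0 < cylRadius (ODE.evolutionMap (fun _ : ℝ => selfSimilarTransport γ 0 V) 0 T y))
    (hvort : ξ₀ * cylRadius (ODE.evolutionMap (fun _ : ℝ => selfSimilarTransport γ 0 V) 0 T y) ≤
      ‖curl U (ODE.evolutionMap (fun _ : ℝ => selfSimilarTransport γ 0 V) 0 T y)‖) :
    ξ₀ * Real.exp ((1 + γ) * T) * cylRadius y ≤ ‖curl U y‖ := by
  set Φ := ODE.evolutionMap (fun _ : ℝ => selfSimilarTransport γ 0 V) 0 with hΦ
  -- the reversed orbit `Y t = Φ_{T−t} y` is a backward orbit of the PROFILE's transport field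
  set Y : ℝ → EuclideanSpace ℝ (Fin 3) := fun t => Φ (T - t) y with hYdef
  have hY : ∀ t ∈ Icc 0 T, HasDerivAt Y ((-1 : ℝ) • selfSimilarTransport γ 0 U (Y t)) t := by
    intro t ht
    have h1 : HasDerivAt (fun r => Φ r y) (selfSimilarTransport γ 0 V (Φ (T - t) y)) (T - t) :=
      hasDerivAt_flow (γ := γ) hV1 hK (T - t) y
    have h2 : HasDerivAt (fun s : ℝ => T - s) (-1 : ℝ) t := by
      simpa using (hasDerivAt_id t).const_sub T
    have h3 := h1.scomp t h2
    have hmem : Φ (T - t) y ∈ ball (0 : EuclideanSpace ℝ (Fin 3)) Rbig :=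
      mem_ball_zero_iff.2 (lt_of_le_of_lt (hstay (T - t) ⟨by linarith [ht.2], by linarith [ht.1]⟩) hRbig)
    rw [selfSimilarTransport_congr hVU hmem] at h3
    exact h3
  have hclock := norm_curl_comp_mul_cylRadius_eq hprof hax hsw hT hY T ⟨hT, le_rfl⟩
  have hYT : Y T = y := by simp [hYdef, hΦ]
  have hY0 : Y 0 = Φ T y := by simp [hYdef]
  rw [hYT, hY0] at hclock
  -- `‖Ω y‖ · r⊥(Φ_T y) = e^{(1+γ)T} ‖Ω(Φ_T y)‖ · r⊥(y) ≥ e^{(1+γ)T} ξ₀ r⊥(Φ_T y) r⊥(y)`; divide by `r⊥(Φ_T y) > 0`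
  have h1 : Real.exp ((1 + γ) * T) * (ξ₀ * cylRadius (Φ T y)) * cylRadius y ≤
      ‖curl U y‖ * cylRadius (Φ T y) := by
    rw [hclock]
    exact mul_le_mul_of_nonneg_right
      (mul_le_mul_of_nonneg_left hvort (Real.exp_pos _).le) (cylRadius_nonneg _)
  have h2 : (ξ₀ * Real.exp ((1 + γ) * T) * cylRadius y) * cylRadius (Φ T y) ≤
      ‖curl U y‖ * cylRadius (Φ T y) := by
    calc (ξ₀ * Real.exp ((1 + γ) * T) * cylRadius y) * cylRadius (Φ T y)
        = Real.exp ((1 + γ) * T) * (ξ₀ * cylRadius (Φ T y)) * cylRadius y := by ring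
      _ ≤ ‖curl U y‖ * cylRadius (Φ T y) := h1
  exact le_of_mul_le_mul_right h2 hoff

/-- **THE STAY-SET CLOCK LAW (ROUND-37 §8 (C′)).**  See the module docstring:
`vol(Φ_T A) ≤ √(32 R B) · ξ₀⁻¹ · e^{−(1−2γ)T}`. [cite: ConstantinIgnatovaVicol2026Putative, §3.4.1 eq. (3.21)–(3.22) (remark after)] -/
theorem volume_image_toReal_le_of_stay (hprof : IsSelfSimilarEulerProfile γ 0 U P)
    (hax : IsAxisymmetric U) (hsw : HasNoSwirl U) (hV2 : ContDiff ℝ 2 V) {K : ℝ}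
    (hK : ∀ y, ‖fderiv ℝ V y‖ ≤ K) {R Rbig : ℝ} (hR : 0 < R) (hRbig : R < Rbig)
    (hVU : ∀ w ∈ ball (0 : EuclideanSpace ℝ (Fin 3)) Rbig, V w = U w) {T : ℝ} (hT : 0 ≤ T)
    {A : Set (EuclideanSpace ℝ (Fin 3))} (hAm : MeasurableSet A)
    (hstay : ∀ y ∈ A, ∀ σ ∈ Icc 0 T,
      ‖ODE.evolutionMap (fun _ : ℝ => selfSimilarTransport γ 0 V) 0 σ y‖ ≤ R)
    {ξ₀ : ℝ} (hξ₀ : 0 < ξ₀)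
    (hvort : ∀ y ∈ A,
      0 < cylRadius (ODE.evolutionMap (fun _ : ℝ => selfSimilarTransport γ 0 V) 0 T y) ∧
        ξ₀ * cylRadius (ODE.evolutionMap (fun _ : ℝ => selfSimilarTransport γ 0 V) 0 T y) ≤
          ‖curl U (ODE.evolutionMap (fun _ : ℝ => selfSimilarTransport γ 0 V) 0 T y)‖)
    (hint : IntegrableOn (fun z => ‖curl U z‖ ^ 2) (closedBall 0 R)) {B : ℝ}
    (hB : ∫ z in closedBall (0 : EuclideanSpace ℝ (Fin 3)) R, ‖curl U z‖ ^ 2 ≤ B) :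
    (volume (ODE.evolutionMap (fun _ : ℝ => selfSimilarTransport γ 0 V) 0 T '' A)).toReal ≤
      Real.sqrt (32 * R * B) / ξ₀ * Real.exp (-((1 - 2 * γ) * T)) := by
  set Φ := ODE.evolutionMap (fun _ : ℝ => selfSimilarTransport γ 0 V) 0 with hΦ
  have hV1 : ContDiff ℝ 1 V := hV2.of_le (by norm_num)
  -- `A ⊆ B̄_R` (σ = 0)
  have hAB : A ⊆ closedBall (0 : EuclideanSpace ℝ (Fin 3)) R := by
    intro y hy
    have h := hstay y hy 0 ⟨le_rfl, hT⟩
    rw [hΦ, ODE.evolutionMap_self] at h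
    exact mem_closedBall_zero_iff.2 h
  have hAfin : volume A < ⊤ := (measure_mono hAB).trans_lt measure_closedBall_lt_top
  set E := Real.exp ((1 + γ) * T) with hE
  have hEpos : 0 < E := Real.exp_pos _
  -- pointwise on `A`: `ξ₀² E² r⊥² ≤ ‖Ω‖²`
  have hpt : ∀ y ∈ A, ξ₀ ^ 2 * E ^ 2 * cylRadius y ^ 2 ≤ ‖curl U y‖ ^ 2 := by
    intro y hy
    have h := mul_exp_mul_cylRadius_le_norm_curl (γ := γ) hprof hax hsw hV1 hK hRbig hVU hT (hstay y hy)
      (hvort y hy).1 (hvort y hy).2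
    have h0 : 0 ≤ ξ₀ * E * cylRadius y := by
      have := cylRadius_nonneg y
      positivity
    calc ξ₀ ^ 2 * E ^ 2 * cylRadius y ^ 2 = (ξ₀ * E * cylRadius y) ^ 2 := by ring
      _ ≤ ‖curl U y‖ ^ 2 := pow_le_pow_left₀ h0 h 2
  -- integrate over `A`: bathtub ≤ ∫_A r⊥² ≤ (ξ₀² E²)⁻¹ ∫_A ‖Ω‖² ≤ (ξ₀² E²)⁻¹ B
  have hr2int : IntegrableOn (fun y => cylRadius y ^ 2) A :=
    ((continuous_cylRadius.pow 2).continuousOn.integrableOn_compact (isCompact_closedBall 0 R)).mono_set hAB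
  have hcurlA : IntegrableOn (fun z => ‖curl U z‖ ^ 2) A := hint.mono_set hAB
  have hbath := sq_volume_le_integral_cylRadius_sq hR hAm hAB
  have hI1 : ∫ y in A, ξ₀ ^ 2 * E ^ 2 * cylRadius y ^ 2 ≤ ∫ y in A, ‖curl U y‖ ^ 2 :=
    setIntegral_mono_on (hr2int.const_mul _) hcurlA hAm hpt
  have hI2 : ∫ y in A, ‖curl U y‖ ^ 2 ≤ ∫ z in closedBall (0 : EuclideanSpace ℝ (Fin 3)) R, ‖curl U z‖ ^ 2 :=
    setIntegral_mono_set hint (Eventually.of_forall fun z => sq_nonneg _) (Eventually.of_forall hAB)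
  rw [integral_const_mul] at hI1
  have hc : 0 < ξ₀ ^ 2 * E ^ 2 := by positivity
  have hB0 : 0 ≤ B := le_trans (setIntegral_nonneg measurableSet_closedBall fun z _ => sq_nonneg _) hB
  -- `v := vol A`, `v² ≤ 32 R B / (ξ₀² E²)`
  set v := (volume A).toReal with hv
  have hv0 : 0 ≤ v := ENNReal.toReal_nonneg
  have hv2 : v ^ 2 ≤ 32 * R * B / (ξ₀ ^ 2 * E ^ 2) := by
    rw [le_div_iff₀ hc]
    have h1 : v ^ 2 / (32 * R) * (ξ₀ ^ 2 * E ^ 2) ≤ B := by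
      calc v ^ 2 / (32 * R) * (ξ₀ ^ 2 * E ^ 2) ≤ (∫ y in A, cylRadius y ^ 2) * (ξ₀ ^ 2 * E ^ 2) :=
            mul_le_mul_of_nonneg_right hbath hc.le
        _ = ξ₀ ^ 2 * E ^ 2 * ∫ y in A, cylRadius y ^ 2 := by ring
        _ ≤ B := (hI1.trans hI2).trans hB
    have h32 : 0 < 32 * R := by positivity
    calc v ^ 2 * (ξ₀ ^ 2 * E ^ 2) = v ^ 2 / (32 * R) * (ξ₀ ^ 2 * E ^ 2) * (32 * R) := by
          field_simp
      _ ≤ B * (32 * R) := mul_le_mul_of_nonneg_right h1 h32.le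
      _ = 32 * R * B := by ring
  have hvle : v ≤ Real.sqrt (32 * R * B) / (ξ₀ * E) := by
    have h1 : v ≤ Real.sqrt (32 * R * B / (ξ₀ ^ 2 * E ^ 2)) := by
      rw [← Real.sqrt_sq hv0]
      exact Real.sqrt_le_sqrt hv2
    rw [Real.sqrt_div (by positivity : (0 : ℝ) ≤ 32 * R * B),
      show ξ₀ ^ 2 * E ^ 2 = (ξ₀ * E) ^ 2 by ring, Real.sqrt_sq (by positivity)] at h1
    exact h1
  -- the volume law
  have hdiv : ∀ z : EuclideanSpace ℝ (Fin 3), ‖z‖ ≤ R → VectorCalculus.divergence V z = 0 := by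
    intro z hz
    have hzball : z ∈ ball (0 : EuclideanSpace ℝ (Fin 3)) Rbig := mem_ball_zero_iff.2 (by linarith)
    have hev : V =ᶠ[𝓝 z] U := by
      filter_upwards [isOpen_ball.mem_nhds hzball] with w hw using hVU w hw
    unfold VectorCalculus.divergence
    rw [hev.fderiv_eq]
    exact hprof.divFree z
  have hvol : volume (Φ T '' A) = ENNReal.ofReal (Real.exp (3 * γ * T)) * volume A :=
    volume_image_flow_eq_exp_of_stay (γ := γ) hV2 hK hT hdiv hAm hstay
  rw [hvol, ENNReal.toReal_mul, ENNReal.toReal_ofReal (Real.exp_pos _).le, ← hv]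
  -- `e^{3γT} v ≤ e^{3γT} √(32RB)/(ξ₀ E) = √(32RB)/ξ₀ · e^{−(1−2γ)T}`
  have hexp : Real.exp (3 * γ * T) = Real.exp (-((1 - 2 * γ) * T)) * E := by
    rw [hE, ← Real.exp_add]
    congr 1
    ring
  calc Real.exp (3 * γ * T) * v ≤ Real.exp (3 * γ * T) * (Real.sqrt (32 * R * B) / (ξ₀ * E)) :=
        mul_le_mul_of_nonneg_left hvle (Real.exp_pos _).le
    _ = Real.sqrt (32 * R * B) / ξ₀ * Real.exp (-((1 - 2 * γ) * T)) := by
        rw [hexp]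
        field_simp

end Summit.NavierStokesRegularity.NavierStokesRegularity.Theorems.PowerGaugeEulerLiouville.NeedleStayClock
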